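import Summits.CriticalPhenomena.PercolationContinuityZ3.Theorems.Transplant.FKConnectivityAllQClusterDomCex
import Summits.CriticalPhenomena.PercolationContinuityZ3.Theorems.Transplant.FKConnectivityAllQArborealLevelDefs
import HarnessLib

/-!
# Connectivity correlation inequalities for `φ_{w,q}` — the LEVELWISE form t-MM (`ClusterDomAdjLevelPos`) fails: corollary of `¬ ClusterDomAdjFKPos`

Support file (`--supports stmt-CriticalPhenomena-4575`), census seat `prim-bschramm-census` (gen 20) of the post-continuity programme; builds on
p205010 (kernel theorem, internal audit signed; external expert review pending).  Proof-only (two short corollaries), no definitions, no named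
facts, no sorries; standard axioms.

fk-1 g10 typed the levelwise strengthening t-MM of MM (`ClusterDomAdjLevelOn` / `ClusterDomAdjLevelPos`: every coefficient of the cross
difference in a uniform scaling `t` of the activities is dominance-nonnegative) together with the reductions `clusterDomAdjOn_of_level` /
`clusterDomAdjFKPos_of_level` (t-MM ⇒ MM).  Since MM is false (`not_clusterDomAdjFKPos`, `…ClusterDomCex`: `K_{1,1,4}`, `q = 1/1000`), so is
t-MM — on the same vertex type `Fin 6` at the same `q`.  (The census of bschramm/FROM-census-g20-MM-REFUTED.md finds t-MM failing much earlier
than MM: already at `p = 1/2`, `q = 1/50` on `K_{1,1,4}`, level `8`; and t-forest-MM at uniform activity `1`, level `8`: `1024 < 1040`.)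
[cite: Grimmett2006, §1.4 eq. (1.20) (p. 15); §3.9 (p. 63)] [cite: AyyerLinussonRavichandran2025, §7 Conj. 7.1 (p. 22)]
-/

noncomputable section

namespace Summit.CriticalPhenomena.PercolationContinuityZ3.Theorems

namespace FK

/-- **t-MM fails on `Fin 6` at `q = 1/1000`**: `¬ ClusterDomAdjLevelOn (Fin 6) (1/1000)` (levelwise ⇒ valuewise, and valuewise fails there).
[cite: Grimmett2006, §1.4 eq. (1.20) (p. 15); §3.9 (p. 63)] -/
theorem not_clusterDomAdjLevelOn_fin_six : ¬ ClusterDomAdjLevelOn (Fin 6) ((1 / 1000 : ℚ) : ℝ) := fun h =>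
  not_clusterDomAdjOn_fin_six (clusterDomAdjOn_of_level (by norm_num) h)

/-- **t-MM fails: `¬ ClusterDomAdjLevelPos`** (fk-1 g10's levelwise master node; refuted-substantive, same witness family as MM).
[cite: Grimmett2006, §1.4 eq. (1.20) (p. 15); §3.9 (p. 63)] -/
theorem not_clusterDomAdjLevelPos : ¬ ClusterDomAdjLevelPos := fun h =>
  not_clusterDomAdjLevelOn_fin_six (h ((1 / 1000 : ℚ) : ℝ) (by norm_num) 6)

end FK

end Summit.CriticalPhenomena.PercolationContinuityZ3.Theorems

end
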